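import Summits.QuantumFields.YangMills.Theorems.BalabanUVNodesK0RecordFormatNamesP0C

/-!
# K0⁷ — THE RECORD-SIDE FORMAT NAMES, EDITION 24 = THE P0-ℂ LETTER WITH ITS a₀-GUARD: `P0HolExtAtRecordG F`
# (= edition 23's `P0HolExtAtRecord F` — ✓p820363, `…K0RecordFormatNamesP0C` :169 — with ONE displayed hypothesis inserted after `∀ a₀ > 0 →`: the consumer's UNIFORM TokE face (G-b))

Cell `ym-nodeO-ideate` ∕ `ym-balaban-port`, DEFINER seat `ym-nodeO-def-1` (gen 37); `--kind definition --supports stmt-QuantumFields-20541 --as helper`; count-neutral.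
[I] = [Balaban1987RG1], [15] = [Balaban1985Variational], [16] = [Balaban1985UV3].

ORDER OF RECORD.  ◆ CRIT-1 g37 l.5141 (3) (nodeO STATUS 2026-08-31T10:37:12Z) MUST-FIX (w3) = node00-def-Y's supplier word UPHELD in the token form; ruling CLOSED l.5189 (10:54:15Z): FACE (G-b),
UNIFORM FORM, GO; the face was PICKED BY THE CONSUMER ▶ PT-A-1 g7 (l.5186) — self-contained, already the currency of the Jac glue (✓`eventually_phiLZdet_eq_logDet`) and of his `…LZdetGerm`;
★★★ director-ym №559 (A)∕№561.  WHY A NEW NAME (this seat, l.5212): the gate's Theorems append-only rule refuses an in-place body change of ✓`P0HolExtAtRecord` (`ledger propose --dry-run` ⇒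
`theorems.append-only`: «deprecate, don't mutate — … definition body changed in place — deprecate-and-add under a new name instead»), so №559's «meaning changes in place» is executed as
«deprecate-and-add»: edition 23's letter stays in the tree UNGUARDED and SUPERSEDED (inhabited nowhere; it IMPLIES this one — `p0HolExtAtRecordG_of_unguarded`), and the consumers re-point by name
(⟨27930⟩ `stub_P0C : ∀ F, P0HolExtAtRecordG F`, `stub_LZdetGlue : ∀ F, P0HolExtAtRecordG F → G3CAtRecord F → PortRecordLZdetHalf F` at ▶ PT-A-1's next skeleton write).

WHY THE GUARD (◆ l.5141 (3)).  Edition 23 typed the letter for EVERY `a₀ > 0`, unguarded, while its ONLY a₀-contact — (P2)'s germ identity through the selector `UkSel F 2 K (k+1) a₀ …`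
(`Classical.choose` under `UkExists ∧ UniqueUkOrbit` at radius `a₀`, ✓`Node00/BackgroundSelOfRecord` :197∕:264) — has no meaning where uniqueness fails, and uniqueness at LARGE `a₀` is in no print
([15] Thm 1 ∕ Prop. 9 live at `a₀ ≤ ε₀`).  A numeric ceiling «`a₀ ≤ aUniq F`» is NO-GO (undischargeable from the consumer ✓`PortRecordLZdetHalf`'s binder list, which carries no upper bound on `a₀`);
the token guard is GO: ONE displayed HYPOTHESIS right after `∀ a₀ : ℝ, 0 < a₀ →` and before `∃ α₀ α₁` — the UNIFORM TokE face
`(∃ ε₁ : ℝ, 0 < ε₁ ∧ ∀ (k n : ℕ) (V : GaugeField (F.P (recordK₀ F Mc k + n)) (k + 1) (SU 2)), PlaqSmall ε₁ V → UkExists F 2 (recordK₀ F Mc k + n) (k + 1) a₀ V ∧ UniqueUkOrbit F 2 (recordK₀ F Mc k + n) (k + 1) a₀ V) →`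
(▶ PT-A-1's bytes, ◆-stamped l.5189).  (Q-ord) receipts (◆): SCOPE — the clause reads only `F, Mc, a₀`, all bound to its left; θ-free (`UkExists ∕ UniqueUkOrbit ∕ PlaqSmall` carry no `letI θ`);
DISCHARGE — by the glue from `PortRecordLZdetHalf`'s own binders (`2·L² ≤ B₃`, `0 < a₀`, `0 < a₁`, `hUk : ∀ ε₁, 0 < ε₁ → ε₁ ≤ a₁ → B₃·ε₁ ≤ a₀ → ∀ k n V, PlaqSmall ε₁ V → UkExists … ∧ UniqueUkOrbit …`,
same `Mc`) at `ε₁ := min a₁ (a₀ ∕ B₃)` — five lines, k∕n-UNIFORM as the face demands; STRENGTH — `∃ ε₁` OUTSIDE `∀ k n` is the uniform (weaker-letter ∕ stronger-hypothesis) form, still dischargeable because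
the consumer's `hUk` is itself uniform; the P0C supplier may let `α₀ α₁` (bound AFTER the guard) depend on `ε₁`; above print's ceiling the token is uninhabited and the clause vacuous — exactly the
supplier's point.  `P0CarrierClauses` (✓ :77) is READ BY NAME — untouched; `G3CAtRecord` reads `P0CarrierClauses` only — prefix-independent.

WHAT THIS FILE IS (definitions + one bridge; statement-form; ONE NEW letter name):
* §26h ★ `P0HolExtAtRecordG (F : T4Family) : Prop` — edition 23's (Q-ord) prefix `∃ c₀ γ₀ γ₁, ∀ δ₀ > 0, ∃ Mth, ∀ Mc ≥ Mth, McGuard → ∀ a₀ > 0, ⟨GUARD⟩ → ∃ α₀ α₁, ∀ ε₂₉ > 0, ∀ k, ∃ carriers,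
  P0CarrierClauses …` — v5's bytes with the one clause inserted (the family `F` an EXPLICIT binder: a record PREDICATE, it stays in `Summits/`).
* `p0HolExtAtRecordG_of_unguarded : P0HolExtAtRecord F → P0HolExtAtRecordG F` — the guarded letter is WEAKER (every supplier of edition 23 supplies it; the hypothesis is dropped).

HONEST FRAMING.  A DISPLAYED STATEMENT — asserted for nothing; its inhabitation is [15] Prop. 9 ∕ Thm 1 (E2) content at the record (porter road №547; node00-def-Y's M2-ℂ ✓`Node00/BgSchemeOfRecordC`
`analyticOnNhd_solOfRecordC` is the germ supplier), NOT proved here or anywhere in the tree; the ∃-carrier is inhabited NOWHERE today; ⟨27930⟩ OPEN (stubs 2∕6 by name), `stub_P0C ∕ stub_G3C ∕ stub_LZdetGlue ∕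
stub_FE` OPEN; ⟨26900⟩ OPEN; K0ᴬ ∕ K1ᴬ ∕ K3ᴬ OPEN; NODE O not inhabited (0∕1); COUNT 8∕28 · K 1∕4 UNMOVED; finite `𝕋⁴_{L^K}` at fixed ε — NOT continuum ∕ ℝ⁴ ∕ OS; **the Yang–Mills mass gap (Clay) is
NOT proved by any of this.**  No `sorry`, `instance`, `notation`; standard axioms.
-/

noncomputable section

open scoped BigOperators Matrix.Norms.L2Operator Topology
open Filter

namespace Summit.QuantumFields.YangMills.Theorems.K0RecordFormatNames

open Literature.MathematicalPhysics.QuantumFieldTheory.Balaban1983to89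
open Literature.MathematicalPhysics.QuantumFieldTheory.Balaban1983to89.Node00
open Literature.MathematicalPhysics.QuantumFieldTheory.Balaban1983to89.T4Continuum (T4Family)

/-! ## §26h  The P0-ℂ letter with its a₀-guard -/

/-- ★ **THE P0-ℂ LETTER WITH ITS a₀-GUARD, `P0HolExtAtRecordG F`** (edition 24) — [15] Prop. 9's Gᶜ-extension READ AT THE RECORD's (2.11) CARRIER, k-UNIFORM, in ▶ PT-A-1's consumer clauses
(P1)–(P5) (`P0CarrierClauses`, edition 23, BY NAME) under ◆ CRIT-1 g37's composition-checked (Q-ord) prefix of edition 23 — **the constants `c₀ γ₀ γ₁` OUTERMOST (a₀-free, δ₀-free), the decay rate `δ₀`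
DEMANDED, the cube threshold `Mth` answering to `δ₀` alone and bound BEFORE `a₀`, then `Mc`, then `a₀`, then — NEW in this edition — the a₀-GUARD: the consumer's UNIFORM TokE face «for SOME `ε₁ > 0`, at EVERY
member volume `recordK₀ F Mc k + n` and level `k + 1`, every `ε₁`-plaquette-small `V` has a background minimiser at radius `a₀` with a UNIQUE critical orbit» (so that (P2)'s selector `UkSel … a₀ …` means print's
minimiser wherever the letter is used; above print's ceiling the face is uninhabited and the letter vacuous there), then the radii `α₀ α₁` (which may depend on `ε₁`), `ε₂₉`, `k`, and the carriers
`(TC, TY, TZY, AdM, AdZ)` LAST**; the body is `P0CarrierClauses F a₀ δ₀ c₀ γ₀ γ₁ Mc α₀ α₁ ε₂₉ k TC TY TZY AdM AdZ`.  The guard is discharged by the (63) glue from ✓`PortRecordLZdetHalf`'s own binder `hUk` at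
`ε₁ := min a₁ (a₀ ∕ B₃)`.  SUPERSEDES edition 23's unguarded `P0HolExtAtRecord` (which implies it, `p0HolExtAtRecordG_of_unguarded`).  DISPLAYED — asserted for nothing; inhabited nowhere today.
[cite: Balaban1985Variational, Prop. 9 p.309, Thm 1 p.279, (117) p.295; Balaban1987RG1, (2.11)–(2.12) pp.267–268, (1.18) p.263, (1.21) p.264, (0.21) p.256; Balaban1985UV3, (63) p.272, (25) p.262] -/
def P0HolExtAtRecordG (F : T4Family) : Prop :=
  ∃ c₀ γ₀ γ₁ : ℝ, 0 < c₀ ∧ 0 < γ₀ ∧ γ₀ ≤ γ₁ ∧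
  ∀ δ₀ : ℝ, 0 < δ₀ → ∃ Mth : ℕ, ∀ Mc : ℕ, Mth ≤ Mc → McGuard F Mc →
  ∀ a₀ : ℝ, 0 < a₀ →
  (∃ ε₁ : ℝ, 0 < ε₁ ∧ ∀ (k n : ℕ) (V : GaugeField (F.P (recordK₀ F Mc k + n)) (k + 1) (SU 2)), PlaqSmall ε₁ V →
    UkExists F 2 (recordK₀ F Mc k + n) (k + 1) a₀ V ∧ UniqueUkOrbit F 2 (recordK₀ F Mc k + n) (k + 1) a₀ V) →
  ∃ α₀ α₁ : ℝ, 0 < α₀ ∧ 0 < α₁ ∧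
  ∀ ε₂₉ : ℝ, 0 < ε₂₉ → ∀ k : ℕ,
    ∃ TC TY TZY AdM AdZ, P0CarrierClauses F a₀ δ₀ c₀ γ₀ γ₁ Mc α₀ α₁ ε₂₉ k TC TY TZY AdM AdZ

/-- **The guarded letter is WEAKER than edition 23's**: `P0HolExtAtRecord F → P0HolExtAtRecordG F` (the a₀-guard hypothesis is simply not used) — every supplier of the unguarded letter supplies this
one; consumers lose nothing by re-pointing. [cite: Balaban1985Variational, Prop. 9 p.309 (bookkeeping)] -/
theorem p0HolExtAtRecordG_of_unguarded {F : T4Family} (h : P0HolExtAtRecord F) : P0HolExtAtRecordG F := by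
  obtain ⟨c₀, γ₀, γ₁, hc₀, hγ₀, hγ, H⟩ := h
  refine ⟨c₀, γ₀, γ₁, hc₀, hγ₀, hγ, fun δ₀ hδ₀ => ?_⟩
  obtain ⟨Mth, hM⟩ := H δ₀ hδ₀
  exact ⟨Mth, fun Mc hMc hG a₀ ha₀ _ => hM Mc hMc hG a₀ ha₀⟩

end Summit.QuantumFields.YangMills.Theorems.K0RecordFormatNames

end
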